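import Literature.Probability.RandomPlanarGeometry.PolylineUniform
import Literature.Probability.RandomPlanarGeometry.SelfAvoidingWalk
import Literature.Probability.LatticeModels.GridDomainConformalGeometry
import HarnessLib

/-!
# The polyline of a self-avoiding walk of `Ω_δ ⊆ δℤ²`: uniform clock, flatness, trace, reversal

Support file for item `stmt-CriticalPhenomena-18057` (`AttachNoReturn`, route `SAWReversalUpgrade`,
sub-problem `SAWScalingLimit`). The route's statements read a self-avoiding walk
`γ : SAW.DomainSAW Ω δ a b` through its dyadic polyline `γ.walk.toCurve (meshPoint δ)`
(`LatticeInterface.lean`: iterated `Path.trans` of segments, constant tail). Using the tree's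
factorisation `polyline = uniform ∘ clock` (`PolylineUniform.lean`) we record:

* `toCurve_apply_eq_uniform_clock` — `γ(t) = U(clock_n t)` with `U` the uniform parametrisation;
* `uniform_walk_apply_add` — on `[i, i+1]` the uniform parametrisation runs the `i`-th edge;
* `uniform_saw_injOn` — for a SELF-AVOIDING walk of `δℤ²` (`δ > 0`), `U` is injective on
  `[0, n]` (two lattice edges meet only in a common endpoint, `LSWGrid.exists_common_endpoint`);
* `toCurve_flat` — hence the dyadic polyline is FLAT: equal values at `s ≤ t` force constancy on
  `[s, t]` (the clock is monotone);
* `toCurve_mem_closure`, `meshPoint_mem_of_ne` — the polyline lies in `closure Ω` and its end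
  points `δa`, `δb` lie in `Ω` (as soon as `a ≠ b`);
* `toCurve_reverse_transfer` — two values met in the order `γ(σ)`, `γ(τ)` (`σ ≤ τ`, distinct) are
  met by the polyline of the REVERSED walk in the opposite order (`uniform_reverse`).
-/

namespace Summit.CriticalPhenomena.SAWScalingLimit.Theorems.AttachNoReturn

open Set Function Topology
open Literature.Probability.LatticeModels Literature.Probability.RandomPlanarGeometry
open Literature.Probability.RandomPlanarGeometry.Polyline

section General

variable {V E : Type*} [AddCommGroup E] [Module ℝ E] [TopologicalSpace E] [ContinuousAdd E]
  [ContinuousSMul ℝ E] {G : SimpleGraph V} {u v : V}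

omit [AddCommGroup E] [Module ℝ E] [TopologicalSpace E] [ContinuousAdd E] [ContinuousSMul ℝ E] in
/-- The embedded support of a walk is `emb u :: (its tail)`. -/
theorem map_support_eq_cons (emb : V → E) (w : G.Walk u v) :
    w.support.map emb = emb u :: (w.support.map emb).tail := by
  conv_lhs => rw [← w.cons_tail_support]
  rw [List.map_cons, List.map_tail]

omit [AddCommGroup E] [Module ℝ E] [TopologicalSpace E] [ContinuousAdd E] [ContinuousSMul ℝ E] in
/-- The tail of the embedded support has `w.length` entries. -/
theorem length_tail_map_support (emb : V → E) (w : G.Walk u v) :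
    (w.support.map emb).tail.length = w.length := by
  rw [List.length_tail, List.length_map, w.length_support]
  rfl

/-- **The polyline of a walk is its uniform polyline run with the dyadic clock.** -/
theorem toCurve_apply_eq_uniform_clock (emb : V → E) (w : G.Walk u v) (t : unitInterval) :
    w.toCurve emb t = uniform (emb u) (w.support.map emb).tail (clock w.length t) := by
  change polyline (w.support.map emb) t = _
  rw [map_support_eq_cons emb w, polyline_apply_eq_uniform_clock, List.tail_cons,
    length_tail_map_support]

omit [AddCommGroup E] [Module ℝ E] [TopologicalSpace E] [ContinuousAdd E] [ContinuousSMul ℝ E] in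
/-- Entries of the embedded support are the embedded vertices `emb (w.getVert k)`. -/
theorem getElem_cons_tail_map_support (emb : V → E) (w : G.Walk u v) (k : ℕ)
    (hk : k < (emb u :: (w.support.map emb).tail).length) :
    (emb u :: (w.support.map emb).tail)[k] = emb (w.getVert k) := by
  rw [List.getElem_of_eq (map_support_eq_cons emb w).symm hk, List.getElem_map,
    w.support_getElem_eq_getVert]

/-- **Edgewise formula**: during `[i, i+1]` (`i < length`) the uniform polyline of a walk runs
affinely along the `i`-th edge, from `emb (w.getVert i)` to `emb (w.getVert (i+1))`. -/
theorem uniform_walk_apply_add (emb : V → E) (w : G.Walk u v) {i : ℕ} (hi : i < w.length)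
    {s : ℝ} (hs : s ∈ Icc (0 : ℝ) 1) :
    uniform (emb u) (w.support.map emb).tail (i + s) =
      AffineMap.lineMap (emb (w.getVert i)) (emb (w.getVert (i + 1))) s := by
  have hi' : i < (w.support.map emb).tail.length := by rwa [length_tail_map_support]
  rw [uniform_apply_add _ _ i hi' hs, getElem_cons_tail_map_support, getElem_cons_tail_map_support]

/-- Values of the uniform polyline on `[0, length]` lie on the edges: `U σ ∈ [v_i, v_{i+1}]` for
some `i < length` with `σ ∈ [i, i+1]`, provided `0 < length`. -/
theorem uniform_walk_mem_segment (emb : V → E) (w : G.Walk u v) (hn : 0 < w.length) {σ : ℝ}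
    (h0 : 0 ≤ σ) (hσ : σ ≤ w.length) :
    ∃ i : ℕ, i < w.length ∧ (i : ℝ) ≤ σ ∧ σ ≤ i + 1 ∧
      uniform (emb u) (w.support.map emb).tail σ ∈
        segment ℝ (emb (w.getVert i)) (emb (w.getVert (i + 1))) := by
  -- write `σ = i + s` with `i < n`, `s ∈ [0, 1]`
  obtain ⟨i, s, hi, hs, rfl⟩ : ∃ (i : ℕ) (s : ℝ), i < w.length ∧ s ∈ Icc (0 : ℝ) 1 ∧ σ = i + s := by
    rcases eq_or_lt_of_le hσ with h | h
    · refine ⟨w.length - 1, 1, by omega, ⟨zero_le_one, le_rfl⟩, ?_⟩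
      rw [h, Nat.cast_sub hn]
      push_cast
      ring
    · refine ⟨⌊σ⌋₊, σ - ⌊σ⌋₊, (Nat.floor_lt h0).2 h, ⟨?_, ?_⟩, by ring⟩
      · linarith [Nat.floor_le h0]
      · linarith [Nat.lt_floor_add_one σ]
  refine ⟨i, hi, by linarith [hs.1], by linarith [hs.2], ?_⟩
  rw [uniform_walk_apply_add emb w hi hs, segment_eq_image_lineMap]
  exact ⟨s, hs, rfl⟩

end General

/-! ### Self-avoiding walks of `Ω_δ ⊆ δℤ²` -/

section Saw

open Literature.Probability.RandomPlanarGeometry.SAW Literature.Probability.Percolation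

variable {Ω : Set ℂ} {δ : ℝ} {a b : Site 2}

/-- An edge of `Ω_δ` is an edge of `ℤ²`. -/
theorem zd_adj_of_adj {x y : Site 2} (h : (discreteDomainGraph Ω δ).Adj x y) : (zdGraph 2).Adj x y :=
  meshGraph_le_zdGraph Ω δ (discreteDomainGraph_le_meshGraph Ω δ h)

/-- Rescaling a point of a mesh edge to the unit lattice. -/
theorem div_mem_segment_of_mem {x y : Site 2} {z : ℂ} (hδ : δ ≠ 0)
    (hz : z ∈ segment ℝ (meshPoint δ x) (meshPoint δ y)) :
    z / δ ∈ segment ℝ (Site.toComplex x) (Site.toComplex y) := by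
  rw [segment_eq_image'] at hz ⊢
  obtain ⟨θ, hθ, rfl⟩ := hz
  refine ⟨θ, hθ, ?_⟩
  have hδ' : (δ : ℂ) ≠ 0 := Complex.ofReal_ne_zero.2 hδ
  simp only [meshPoint, Complex.real_smul]
  field_simp

/-- Distances of mesh points scale with `δ > 0`. -/
theorem dist_meshPoint (hδ : 0 < δ) (x : Site 2) (z : ℂ) :
    dist z (meshPoint δ x) = δ * dist (z / δ) (Site.toComplex x) := by
  have hδ' : (δ : ℂ) ≠ 0 := Complex.ofReal_ne_zero.2 hδ.ne'
  rw [dist_eq_norm, dist_eq_norm, meshPoint]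
  have : z - (δ : ℂ) * Site.toComplex x = (δ : ℂ) * (z / δ - Site.toComplex x) := by
    field_simp
  rw [this, norm_mul, Complex.norm_real, Real.norm_of_nonneg hδ.le]

/-- Consecutive mesh points of a walk of `Ω_δ` are at distance `δ`. -/
theorem dist_meshPoint_getVert_succ (hδ : 0 < δ) (γ : DomainSAW Ω δ a b) {i : ℕ}
    (hi : i < γ.walk.length) :
    dist (meshPoint δ (γ.walk.getVert i)) (meshPoint δ (γ.walk.getVert (i + 1))) = δ := by
  have hadj := zd_adj_of_adj (γ.walk.adj_getVert_succ hi)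
  rw [dist_comm, dist_eq_norm, meshPoint, meshPoint, ← mul_sub, norm_mul,
    Complex.norm_real, Real.norm_of_nonneg hδ.le, LSWGrid.norm_toComplex_sub_of_adj hadj, mul_one]

/-- **The uniform polyline of a self-avoiding walk of `δℤ²` is injective on `[0, length]`**
(`δ > 0`): two edges of a self-avoiding lattice path meet only at a common endpoint
(`LSWGrid.exists_common_endpoint`, `LSWGrid.one_le_dist_of_mem_segment`), and each edge is run
affinely. -/
theorem uniform_saw_injOn (hδ : 0 < δ) (γ : DomainSAW Ω δ a b) :
    InjOn (uniform (meshPoint δ a) (γ.walk.support.map (meshPoint δ)).tail)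
      (Icc (0 : ℝ) γ.walk.length) := by
  set n := γ.walk.length with hn
  set U := uniform (meshPoint δ a) (γ.walk.support.map (meshPoint δ)).tail with hU
  set p : ℕ → ℂ := fun k => meshPoint δ (γ.walk.getVert k) with hp
  -- vertices are distinct (self-avoidance) and consecutive ones are adjacent in `ℤ²`
  have hvinj : ∀ k m, k ≤ n → m ≤ n → γ.walk.getVert k = γ.walk.getVert m → k = m :=
    fun k m hk hm h => γ.isPath.getVert_injOn (by exact hk) (by exact hm) h
  have hadj : ∀ k, k < n → (zdGraph 2).Adj (γ.walk.getVert k) (γ.walk.getVert (k + 1)) :=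
    fun k hk => zd_adj_of_adj (γ.walk.adj_getVert_succ hk)
  have hpne : ∀ k, k < n → p k ≠ p (k + 1) := by
    intro k hk h
    have := dist_meshPoint_getVert_succ hδ γ hk
    rw [show meshPoint δ (γ.walk.getVert k) = p k from rfl, h, dist_self] at this
    exact hδ.ne' this.symm
  -- edgewise formula
  have hUseg : ∀ k, k < n → ∀ s ∈ Icc (0 : ℝ) 1, U (k + s) = AffineMap.lineMap (p k) (p (k + 1)) s :=
    fun k hk s hs => uniform_walk_apply_add (meshPoint δ) γ.walk hk hs
  -- canonical decomposition `σ = i + s`, `s < 1` unless `σ = n`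
  have hdec : ∀ σ ∈ Icc (0 : ℝ) n, 0 < n → ∃ (i : ℕ) (s : ℝ), i < n ∧ s ∈ Icc (0 : ℝ) 1 ∧
      σ = i + s ∧ (s < 1 ∨ σ = n) ∧ (σ < n → i = ⌊σ⌋₊) := by
    intro σ hσ hn0
    rcases eq_or_lt_of_le hσ.2 with h | h
    · refine ⟨n - 1, 1, by omega, ⟨zero_le_one, le_rfl⟩, ?_, Or.inr h, fun h' => absurd h h'.ne⟩
      rw [h, Nat.cast_sub hn0]
      push_cast
      ring
    · refine ⟨⌊σ⌋₊, σ - ⌊σ⌋₊, (Nat.floor_lt hσ.1).2 h, ⟨?_, ?_⟩, by ring, Or.inl ?_, fun _ => rfl⟩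
      · linarith [Nat.floor_le hσ.1]
      · linarith [Nat.lt_floor_add_one σ]
      · linarith [Nat.lt_floor_add_one σ]
  -- a common point of the edges `k` and `m ≥ k + 2` does not exist; of `k`, `k+1` it is `p (k+1)`
  have hfar : ∀ k m, k + 2 ≤ m → m < n → ∀ z, z ∈ segment ℝ (p k) (p (k + 1)) →
      z ∉ segment ℝ (p m) (p (m + 1)) := by
    intro k m hkm hm z hz hz'
    have h1 := div_mem_segment_of_mem hδ.ne' hz
    have h2 := div_mem_segment_of_mem hδ.ne' hz'
    obtain ⟨x, hx1, hx2⟩ := LSWGrid.exists_common_endpoint (hadj k (by omega)) (hadj m hm) ⟨_, h1, h2⟩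
    rcases hx1 with rfl | rfl <;> rcases hx2 with h | h
    · have := hvinj k m (by omega) (by omega) h; omega
    · have := hvinj k (m + 1) (by omega) (by omega) h; omega
    · have := hvinj (k + 1) m (by omega) (by omega) h; omega
    · have := hvinj (k + 1) (m + 1) (by omega) (by omega) h; omega
  have hnext : ∀ k, k + 1 < n → ∀ z, z ∈ segment ℝ (p k) (p (k + 1)) →
      z ∈ segment ℝ (p (k + 1)) (p (k + 2)) → z = p (k + 1) := by
    intro k hk z hz hz'
    -- `dist (p (k+1)) z + dist z (p (k+2)) = δ` and `dist z (p (k+2)) ≥ δ`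
    have hsum := dist_add_dist_of_mem_segment hz'
    rw [dist_meshPoint_getVert_succ hδ γ hk] at hsum
    have hne1 : γ.walk.getVert (k + 2) ≠ γ.walk.getVert k := fun h =>
      absurd (hvinj _ _ (by omega) (by omega) h) (by omega)
    have hne2 : γ.walk.getVert (k + 2) ≠ γ.walk.getVert (k + 1) := fun h =>
      absurd (hvinj _ _ (by omega) (by omega) h) (by omega)
    have hge : δ ≤ dist z (p (k + 2)) := by
      have h1 := LSWGrid.one_le_dist_of_mem_segment (hadj k (by omega)) hne1 hne2
        (div_mem_segment_of_mem hδ.ne' hz)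
      have := dist_meshPoint hδ (γ.walk.getVert (k + 2)) z
      change dist z (p (k + 2)) = _ at this
      rw [this]
      nlinarith
    have h0 : dist (p (k + 1)) z ≤ 0 := by linarith
    exact (dist_le_zero.1 h0).symm
  -- the injectivity
  intro σ hσ σ' hσ' heq
  rcases Nat.eq_zero_or_pos n with hn0 | hn0
  · -- no edge: `[0, n] = {0}`
    have h1 : σ = 0 := le_antisymm (by simpa [hn0] using hσ.2) hσ.1
    have h2 : σ' = 0 := le_antisymm (by simpa [hn0] using hσ'.2) hσ'.1
    rw [h1, h2]
  -- reduce to `σ ≤ σ'`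
  wlog hle : σ ≤ σ' generalizing σ σ'
  · exact (this hσ' hσ heq.symm (le_of_not_ge hle)).symm
  obtain ⟨i, s, hi, hs, rfl, hs1, hfl⟩ := hdec σ hσ hn0
  obtain ⟨i', s', hi', hs', rfl, hs1', hfl'⟩ := hdec σ' hσ' hn0
  have hz : U (i + s) ∈ segment ℝ (p i) (p (i + 1)) := by
    rw [hUseg i hi s hs, segment_eq_image_lineMap]
    exact ⟨s, hs, rfl⟩
  have hz' : U (i + s) ∈ segment ℝ (p i') (p (i' + 1)) := by
    rw [heq, hUseg i' hi' s' hs', segment_eq_image_lineMap]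
    exact ⟨s', hs', rfl⟩
  -- `i ≤ i'`
  have hii' : i ≤ i' := by
    rcases hs1' with hlt' | heqn'
    · -- `σ' < n`, hence `σ < n` and both indices are floors
      have hσ'n : (i' : ℝ) + s' < n := by
        have : (i' : ℝ) + 1 ≤ n := by exact_mod_cast hi'
        linarith
      have hσn : (i : ℝ) + s < n := lt_of_le_of_lt hle hσ'n
      rw [hfl hσn, hfl' hσ'n]
      exact Nat.floor_mono hle
    · have h1 : i + 1 ≤ n := hi
      have h2 : (i' : ℝ) + s' = n := heqn'
      have h3 : (n : ℝ) ≤ (i' : ℝ) + 1 := by linarith [hs'.2]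
      have h4 : n ≤ i' + 1 := by exact_mod_cast h3
      omega
  rcases hii'.eq_or_lt with heqi | hlti
  · -- same edge: the affine parametrisation is injective
    subst heqi
    have hinj := AffineMap.lineMap_injective (k := ℝ) (hpne i hi)
    have : s = s' := hinj (by rw [← hUseg i hi s hs, ← hUseg i hi' s' hs', heq])
    rw [this]
  rcases Nat.lt_or_ge (i + 1) i' with hlti2 | hge
  swap
  · -- consecutive edges: the common point is the common vertex, so `s = 1`: impossible
    exfalso
    obtain rfl : i' = i + 1 := by omega
    have hi1 : i + 1 < n := hi'
    have hval : U (i + s) = p (i + 1) := hnext i hi1 _ hz hz'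
    have hs_eq : s = 1 := by
      have hinj := AffineMap.lineMap_injective (k := ℝ) (hpne i hi)
      apply hinj
      rw [← hUseg i hi s hs, hval, AffineMap.lineMap_apply_one]
    rcases hs1 with hlt | heqn
    · rw [hs_eq] at hlt
      exact (lt_irrefl _) hlt
    · -- `σ = n`, but the edge `i + 1 = i'` exists, so `i + 1 < n`
      have h1 : (i : ℝ) + s = n := heqn
      rw [hs_eq] at h1
      have h3 : (i : ℝ) + 1 < n := by exact_mod_cast hi1
      linarith
  · -- edges `i` and `i' ≥ i + 2` are disjoint
    exact absurd hz' (hfar i i' (by omega) hi' _ hz)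

/-- **Flatness of the dyadic polyline of a self-avoiding walk**: if `γ(s) = γ(t)` with `s ≤ t`
then `γ` is constant on `[s, t]` (the only constancy intervals are those of the dyadic clock). -/
theorem toCurve_flat (hδ : 0 < δ) (γ : DomainSAW Ω δ a b) {s t : unitInterval}
    (heq : γ.walk.toCurve (meshPoint δ) s = γ.walk.toCurve (meshPoint δ) t) (w : unitInterval)
    (hsw : s ≤ w) (hwt : w ≤ t) :
    γ.walk.toCurve (meshPoint δ) w = γ.walk.toCurve (meshPoint δ) s := by
  rw [toCurve_apply_eq_uniform_clock, toCurve_apply_eq_uniform_clock] at heq ⊢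
  have hmem : ∀ r : unitInterval, clock γ.walk.length r ∈ Icc (0 : ℝ) γ.walk.length :=
    fun r => clock_mem_Icc _ ⟨r.2.1, r.2.2⟩
  have hcl : clock γ.walk.length s = clock γ.walk.length t :=
    uniform_saw_injOn hδ γ (hmem s) (hmem t) heq
  have h1 : clock γ.walk.length s ≤ clock γ.walk.length w := monotone_clock _ (Subtype.coe_le_coe.2 hsw)
  have h2 : clock γ.walk.length w ≤ clock γ.walk.length t := monotone_clock _ (Subtype.coe_le_coe.2 hwt)
  rw [le_antisymm (hcl ▸ h2) h1]

/-- The end points of a self-avoiding walk with `a ≠ b` lie in the discrete domain, so their mesh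
points lie in (the open set) `Ω`. -/
theorem meshPoint_mem_of_ne (γ : DomainSAW Ω δ a b) (hab : a ≠ b) :
    meshPoint δ a ∈ Ω ∧ meshPoint δ b ∈ Ω := by
  have hn : 0 < γ.walk.length := by
    rcases Nat.eq_zero_or_pos γ.walk.length with h | h
    · exact absurd (SimpleGraph.Walk.eq_of_length_eq_zero h) hab
    · exact h
  have h0 := γ.walk.adj_getVert_succ hn
  have h1 := γ.walk.adj_getVert_succ (Nat.sub_one_lt_of_lt hn)
  rw [SimpleGraph.Walk.getVert_zero] at h0
  rw [Nat.sub_add_cancel hn, SimpleGraph.Walk.getVert_length] at h1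
  exact ⟨meshDomain_subset_meshVertices Ω δ (discreteDomainGraph_adj_iff.1 h0).2.1,
    meshDomain_subset_meshVertices Ω δ (discreteDomainGraph_adj_iff.1 h1).2.2⟩

/-- **The polyline of a self-avoiding walk of `Ω_δ` with `a ≠ b` lies in `closure Ω`**
(every edge of `Ω_δ` is a closed segment of `closure Ω`). -/
theorem toCurve_mem_closure (γ : DomainSAW Ω δ a b) (hab : a ≠ b) (t : unitInterval) :
    γ.walk.toCurve (meshPoint δ) t ∈ closure Ω := by
  have hn : 0 < γ.walk.length := by
    rcases Nat.eq_zero_or_pos γ.walk.length with h | h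
    · exact absurd (SimpleGraph.Walk.eq_of_length_eq_zero h) hab
    · exact h
  rw [toCurve_apply_eq_uniform_clock]
  obtain ⟨h0, h1⟩ := clock_mem_Icc γ.walk.length ⟨t.2.1, t.2.2⟩
  obtain ⟨i, hi, -, -, hmem⟩ := uniform_walk_mem_segment (meshPoint δ) γ.walk hn h0 h1
  exact (meshGraph_adj_iff.1 (discreteDomainGraph_le_meshGraph Ω δ (γ.walk.adj_getVert_succ hi))).2 hmem

/-- The polyline of a walk ends at the mesh point of its final vertex. -/
theorem toCurve_apply_one (γ : DomainSAW Ω δ a b) :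
    γ.walk.toCurve (meshPoint δ) 1 = meshPoint δ b := by
  rw [toCurve_apply_eq_uniform_clock, show ((1 : unitInterval) : ℝ) = 1 from rfl, clock_one]
  rcases Nat.eq_zero_or_pos γ.walk.length with h0 | hpos
  · have hab : a = b := SimpleGraph.Walk.eq_of_length_eq_zero h0
    have htail : (γ.walk.support.map (meshPoint δ)).tail = [] :=
      List.eq_nil_of_length_eq_zero (by rw [length_tail_map_support, h0])
    rw [htail, uniform_nil, hab]
  · have h := uniform_walk_apply_add (meshPoint δ) γ.walk (i := γ.walk.length - 1) (by omega)
      (s := 1) ⟨zero_le_one, le_rfl⟩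
    rw [Nat.sub_add_cancel hpos, SimpleGraph.Walk.getVert_length, AffineMap.lineMap_apply_one] at h
    rw [← h]
    congr 1
    rw [Nat.cast_sub hpos]
    push_cast
    ring

/-- **Reversal transfer.** If the polyline of `γ` takes two distinct values at times `σ ≤ τ`,
then the polyline of the reversed walk `γ^R` takes the value `γ(τ)` strictly before the value
`γ(σ)`: both polylines are the same uniform polyline run with monotone onto clocks, the second
one backwards (`Polyline.uniform_reverse`). -/
theorem toCurve_reverse_transfer (γ : DomainSAW Ω δ a b) {σ τ : unitInterval} (hστ : σ ≤ τ)
    (hne : γ.walk.toCurve (meshPoint δ) σ ≠ γ.walk.toCurve (meshPoint δ) τ) :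
    ∃ s t : unitInterval, s < t ∧
      γ.walk.reverse.toCurve (meshPoint δ) s = γ.walk.toCurve (meshPoint δ) τ ∧
      γ.walk.reverse.toCurve (meshPoint δ) t = γ.walk.toCurve (meshPoint δ) σ := by
  set n := γ.walk.length with hn
  set L := γ.walk.support.map (meshPoint δ) with hL
  have hLcons : L = meshPoint δ a :: L.tail := map_support_eq_cons _ _
  have hLne : L ≠ [] := by rw [hLcons]; exact List.cons_ne_nil _ _
  have hLlen : L.length = n + 1 := by rw [hL, List.length_map, SimpleGraph.Walk.length_support]
  have hhead : ∀ (M : List ℂ) (hM : M ≠ []) (c : ℂ), M = c :: M.tail → M.head hM = c := by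
    intro M hM c h
    cases M with
    | nil => exact absurd rfl hM
    | cons x xs => exact (List.cons.inj h).1
  -- the reversed list is the embedded support of the reversed walk
  have hLrev : γ.walk.reverse.support.map (meshPoint δ) = L.reverse := by
    rw [SimpleGraph.Walk.support_reverse, List.map_reverse]
  have hLrcons : L.reverse = meshPoint δ b :: L.reverse.tail := by
    rw [← hLrev]; exact map_support_eq_cons _ _
  have hLrne : L.reverse ≠ [] := by simpa using hLne
  -- both polylines through the uniform polyline `U`
  set U := uniform (L.head hLne) L.tail with hU
  have hP : ∀ t : unitInterval, γ.walk.toCurve (meshPoint δ) t = U (clock n t) := by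
    intro t
    rw [toCurve_apply_eq_uniform_clock, hU, hhead L hLne _ hLcons]
  have hPR : ∀ t : unitInterval, γ.walk.reverse.toCurve (meshPoint δ) t = U (n - clock n t) := by
    intro t
    rw [toCurve_apply_eq_uniform_clock, SimpleGraph.Walk.length_reverse, hLrev, hU,
      ← hhead L.reverse hLrne _ hLrcons]
    exact uniform_reverse L hLne hLlen (clock_nonneg n t.2.1) (clock_mem_Icc n ⟨t.2.1, t.2.2⟩).2
  -- the two clock values
  have hα := clock_mem_Icc n ⟨σ.2.1, σ.2.2⟩
  have hβ := clock_mem_Icc n ⟨τ.2.1, τ.2.2⟩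
  have hαβ : clock n σ < clock n τ := by
    refine lt_of_le_of_ne (monotone_clock n (Subtype.coe_le_coe.2 hστ)) fun h => hne ?_
    rw [hP, hP, h]
  -- times of the reversed clock hitting `n - β` and `n - α`
  have hsurj : Icc (0 : ℝ) n ⊆ clock n '' Icc (0 : ℝ) 1 := by
    have := intermediate_value_Icc zero_le_one (continuous_clock n).continuousOn
    rwa [clock_zero, clock_one] at this
  obtain ⟨s, hs, hs'⟩ := hsurj (show (n : ℝ) - clock n τ ∈ Icc (0 : ℝ) n from
    ⟨by linarith [hβ.2], by linarith [hβ.1]⟩)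
  obtain ⟨t, ht, ht'⟩ := hsurj (show (n : ℝ) - clock n σ ∈ Icc (0 : ℝ) n from
    ⟨by linarith [hα.2], by linarith [hα.1]⟩)
  refine ⟨⟨s, hs⟩, ⟨t, ht⟩, ?_, ?_, ?_⟩
  · by_contra h
    push Not at h
    have := monotone_clock n (Subtype.coe_le_coe.2 h)
    change clock n t ≤ clock n s at this
    rw [hs', ht'] at this
    linarith
  · rw [hPR, hP]
    change U (n - clock n s) = _
    rw [hs', sub_sub_cancel]
  · rw [hPR, hP]
    change U (n - clock n t) = _
    rw [ht', sub_sub_cancel]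

end Saw

end Summit.CriticalPhenomena.SAWScalingLimit.Theorems.AttachNoReturn
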